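import Summits.BirchSwinnertonDyer.BirchSwinnertonDyer.Theses.KolyvaginRankRigidityAtTwo
import Summits.BirchSwinnertonDyer.BirchSwinnertonDyer.Theorems.KolyvaginRankRigidityAtTwoAdmissibleAtTwo
import Summits.BirchSwinnertonDyer.BirchSwinnertonDyer.Theorems.KolyvaginRoadThreeClassCertificate
import Literature.NumberTheory.EllipticCurves.BSDSelmerPConverseYanZhuKolyvaginSystemProofs
import Literature.NumberTheory.EllipticCurves.HeegnerPointsOfConductorOneGaloisConjProofs
import Literature.NumberTheory.EllipticCurves.MordellWeilTheoremProofs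
import HarnessLib

/-!
# Crux V1′ `KolyvaginNonvanishingAtTwoFrame` (stmt-BirchSwinnertonDyer-24622), stub
# `stub_nonTorsionLevelOne`: the BOTTOM case of Kolyvagin's conjecture at `p = 2` — a level-one
# datum with `P(1) = y_K` of infinite order gives a non-zero class `c_M(1) ≠ 0`

The planner's registered BC3 birth skeleton of V1′ (Kolyvagin's conjecture AT `p = 2` on the
surjective-2-adic habitat, universal frame `Dt, β, ι`) splits at level one: `stub_nonTorsionLevelOne`
(some conductor-`1` datum has `P(1)` of infinite order ⇒ a non-zero Kolyvagin class) and
`stub_torsionLevelOne` (every `P(1)` torsion ⇒ a non-zero class of positive depth: the research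
content). This file PROVES the first, unconditionally ("Kummer injectivity, provable now"):

* `exists_not_two_pow_zsmul_eq` — a point of infinite order of a finitely generated abelian group is
  not divisible by every power of `2` (Gross 1991 §2; McCallum 1991 §5, `M₀ < ∞`);
* `toGeomPoints_derivedPoint_one_mem_invPoints` — `P(1) = Tr_{K[1]/K} y(1)` descends to `E(K)`
  (tree: `heegnerSystem_exists_isHeegnerPoint_map_eq_derivedPoint_one` + the THEOREM
  `heegnerPointOfConductor_one_galoisConj_holds`), hence is `Γ_K`-invariant in `E(K̄)` (x11b3's
  `smul_toGeomPoints_eq`: `Γ_K` acts on `E(K[1])` through `Gal(K[1]/K)`), so McCallum's (4) holds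
  at every modulus;
* `stub_nonTorsionLevelOne` — with the admissibility of `E(K[1]) ⊆ E(K̄)` for `2^M` on the habitat
  (`KolyvaginAtTwo.isAdmissible_pointsSubgroup_two_of_heegner`, Gross Lemma 4.3 at `2`) and
  McCallum's Cor. 4.5 in the tree's iff form (`KolyCert.kolyvaginClass_ne_zero_iff`:
  `c_M(n) ≠ 0 ⟺ admissible ∧ invariant ∧ 2^M ∤ P(n)`), the class `c_M(1)` is non-zero at the
  level `M ≥ 1` where `2^M ∤ P(1)` in the finitely generated `E(K[1])` (Mordell–Weil,
  `module_finite_point_holds`); `n = 1` is Kolyvagin-square-free and `M ≤ M(1) = ∞`.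

HONEST FRAMING: the EASY half of V1′ (the deep half `stub_torsionLevelOne` — `y_K` torsion, i.e.
`ord_{s=1} L(E/K,s) ≥ 3` — is Kolyvagin's conjecture proper at `2` and stays open); closes nothing
by itself; BSD is not proved by any of this.
-/

set_option autoImplicit false
-- the Theorems namespace of this sub repeats the summit name by design (D-0017 nested layout)
set_option linter.dupNamespace false

noncomputable section

open scoped Classical

open WeierstrassCurve Field Literature.NumberTheory.EllipticCurves
  Literature.NumberTheory.EllipticCurves.ModularForms

namespace Summit.BirchSwinnertonDyer.BirchSwinnertonDyer.Theorems.KolyvaginAtTwo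

/-- **A point of infinite order in a finitely generated abelian group is not divisible by every
power of `2`** (Gross 1991, §2: "since `E(K)` is finitely generated, the point `y_K` is not
infinitely divisible"; McCallum 1991 §5, `M₀ = ord_p [E(K) : ℤ y_K] < ∞`): some coordinate `c ≠ 0`
of the image of `y` in the free quotient `A/A_tors`, and `2^M ∣ c` fails for `2^M > |c|`.
[cite: GrossLMS1991, §2 (paragraph before Prop. 2.1)] -/
theorem exists_not_two_pow_zsmul_eq {A : Type*} [AddCommGroup A] [Module.Finite ℤ A] {y : A}
    (hy : ¬ IsOfFinAddOrder y) : ∃ M : ℕ, 1 ≤ M ∧ ¬ ∃ Q : A, ((2 ^ M : ℕ) : ℤ) • Q = y := by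
  set T := AddCommGroup.torsion A with hT_def
  let π : A →ₗ[ℤ] A ⧸ T := (QuotientAddGroup.mk' T).toIntLinearMap
  have hπ : Function.Surjective π := QuotientAddGroup.mk'_surjective T
  haveI : Module.Finite ℤ (A ⧸ T) := Module.Finite.of_surjective π hπ
  haveI : NoZeroSMulDivisors ℤ (A ⧸ T) := inferInstance
  haveI : Module.Free ℤ (A ⧸ T) := Module.free_of_finite_type_torsion_free'
  have hy' : π y ≠ 0 := by
    intro h
    apply hy
    have hmem : y ∈ T := (QuotientAddGroup.eq_zero_iff y).mp h
    exact hmem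
  let b := Module.Free.chooseBasis ℤ (A ⧸ T)
  obtain ⟨i, hi⟩ : ∃ i, b.repr (π y) i ≠ 0 := by
    by_contra h
    push Not at h
    exact hy' (b.repr.injective (Finsupp.ext fun i ↦ by simpa using h i))
  -- the exponent `k = |c| + 1`, `c` the `i`-th coordinate of `ȳ`
  obtain ⟨k, hk⟩ : ∃ k : ℕ, k = (b.repr (π y) i).natAbs + 1 := ⟨_, rfl⟩
  refine ⟨k, by omega, ?_⟩
  rintro ⟨Q, hQ⟩
  have hdvd : ((2 ^ k : ℕ) : ℤ) ∣ b.repr (π y) i := by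
    refine ⟨b.repr (π Q) i, ?_⟩
    have h1 : π y = ((2 ^ k : ℕ) : ℤ) • π Q := by
      rw [← hQ, map_zsmul]
    rw [h1, map_zsmul, Finsupp.smul_apply, smul_eq_mul]
  have hdvd' : 2 ^ k ∣ (b.repr (π y) i).natAbs := by
    have := Int.natAbs_dvd_natAbs.mpr hdvd
    simpa using this
  have hle : 2 ^ k ≤ (b.repr (π y) i).natAbs := Nat.le_of_dvd (Int.natAbs_pos.mpr hi) hdvd'
  have hlt : (b.repr (π y) i).natAbs < 2 ^ k :=
    hk ▸ (Nat.lt_two_pow_self).trans (Nat.pow_lt_pow_right (by norm_num) (Nat.lt_succ_self _))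
  omega

section Invariance

variable {K : Type} [Field K] [NumberField K] {W : WeierstrassCurve ℚ} [NeZero (W.conductorNorm ℤ)]
  {Dt : ModularParametrizationData W (W.conductorNorm ℤ)} {β : ℤ} {ι : K →+* ℂ}

/-- **`P(1) = Tr_{K[1]/K} y(1)` is `Γ_K`-invariant in `E(K̄)`** (Gross 1991 §4, `P_1 = y_K ∈ E(K)`):
`P(1)` descends to `E(K)` (tree: `heegnerSystem_exists_isHeegnerPoint_map_eq_derivedPoint_one`, with
reciprocity at conductor `1` the tree THEOREM `heegnerPointOfConductor_one_galoisConj_holds`), and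
`Γ_K` acts on `E(K[1]) ⊆ E(K̄)` through `Gal(K[1]/K)` (x11b3's `smul_toGeomPoints_eq`), which fixes
the image of `E(K)`. So `[P(1)]` is `Γ_K`-invariant mod `m` for EVERY modulus `m` (McCallum's (4),
`invPoints`). [cite: GrossLMS1991, §4 (4.1), Prop. 3.6] [cite: McCallumLMS1991, §4 (4)] -/
theorem toGeomPoints_derivedPoint_one_mem_invPoints [W.IsElliptic] (hK : IsImaginaryQuadratic K)
    (hH : SatisfiesHeegnerHypothesis (W.conductorNorm ℤ) K) (d₁ : KolyvaginHeegnerData Dt β ι 1)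
    (m : ℤ) :
    d₁.toGeomPoints d₁.derivedPoint ∈
      KolyvaginCocycle.invPoints (absoluteGaloisGroup K) d₁.pointsSubgroup m := by
  refine KolyvaginCocycle.mem_invPoints_of_fixed ⟨d₁.derivedPoint, rfl⟩ fun g ↦ ?_
  obtain ⟨P₀, -, hP₀⟩ := heegnerSystem_exists_isHeegnerPoint_map_eq_derivedPoint_one
    (heegnerPointOfConductor_one_galoisConj_holds _ W K) hK hH d₁
  rw [Summit.BirchSwinnertonDyer.Rank1Residual.X11b.RingClassNoTorsion.smul_toGeomPoints_eq d₁ hK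
    one_ne_zero g]
  congr 1
  letI : Algebra (ringClassField K ι 1) (AlgebraicClosure K) := d₁.emb.toAlgebra
  haveI : IsScalarTower K (ringClassField K ι 1) (AlgebraicClosure K) :=
    IsScalarTower.of_algebraMap_eq fun k ↦ (d₁.emb_apply k).symm
  haveI : Normal K (ringClassField K ι 1) :=
    (finiteDimensional_and_isGalois_ringClassField hK ι one_ne_zero).2.to_normal
  set σ := (show AlgebraicClosure K ≃ₐ[K] AlgebraicClosure K from g).restrictNormal
    (ringClassField K ι 1) with hσ
  rw [WeierstrassCurve.smul_def, ← hP₀]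
  rcases P₀ with _ | ⟨x, y, hxy⟩
  · rfl
  · simp only [WeierstrassCurve.Affine.Point.map_some, WeierstrassCurve.Affine.Point.some.injEq]
    exact ⟨σ.commutes x, σ.commutes y⟩

end Invariance

/-! ## The stub -/

/-- **`stub_nonTorsionLevelOne` of V1′ `KolyvaginNonvanishingAtTwoFrame` (registered on
stmt-BirchSwinnertonDyer-24622), PROVED**: on V1′'s habitat (`W` globally minimal, non-CM,
good-ordinary-or-multiplicative at `2`, all `ρ̄_{E,2^m}` onto; `K` imaginary quadratic, Heegner for
`N_E`, `d_K` odd `≠ −3`, `E(K)[2] = 0`, `2` split; frame `Dt, β, ι` with `4N ∣ β² − d_K`), if some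
conductor-`1` Kolyvagin–Heegner datum `d₁` has `P(1)` of infinite order then some Kolyvagin class
is non-zero: `c_M(1) = d₁.kolyvaginClass Nat.prime_two M ≠ 0` at a level `M ≥ 1` with
`2^M ∤ P(1)` in `E(K[1])` (`n = 1`, `M(1) = ∞`). Only `ρ̄_{E,2}` onto, `K` imaginary quadratic,
Heegner and `d_K` odd are used; the other binders are idle and kept to match the registered
signature. [cite: GrossLMS1991, §2, Lemma 4.3, §4 (4.1), Prop. 4.7 (1)]
[cite: McCallumLMS1991, §4 (4)–(6), Cor. 4.5, §5 Lemma 5.1] -/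
theorem stub_nonTorsionLevelOne :
    ∀ (W : WeierstrassCurve ℚ) [W.IsElliptic] [W.IsGloballyMinimal], ¬ W.HasCM →
      (Literature.NumberTheory.EllipticCurves.Rank1Residual.GoodOrd W 2 ∨
      Literature.NumberTheory.EllipticCurves.Rank1Residual.Mult W 2) → (∀ m : ℕ,
      W.HasSurjectiveModNGaloisRep (2 ^ m : ℕ)) → ∀ (K : Type) [Field K] [NumberField K],
      Literature.NumberTheory.EllipticCurves.IsImaginaryQuadratic K → ∀ [NeZero (W.conductorNorm
      ℤ)], Literature.NumberTheory.EllipticCurves.SatisfiesHeegnerHypothesis (W.conductorNorm ℤ) K →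
      Odd (NumberField.discr K) → NumberField.discr K ≠ -3 → AddSubgroup.torsionBy (W.baseChange
      K).toAffine.Point (2 : ℤ) = ⊥ →
      Literature.NumberTheory.EllipticCurves.SatisfiesHeegnerHypothesis 2 K → ∀ (Dt :
      Literature.NumberTheory.EllipticCurves.ModularForms.ModularParametrizationData W
      (W.conductorNorm ℤ)) (β : ℤ) (ι : K →+* ℂ), (4 * (W.conductorNorm ℤ : ℤ)) ∣ β ^ 2 -
      NumberField.discr K → (∃ d₁ : Literature.NumberTheory.EllipticCurves.KolyvaginHeegnerData Dt β
      ι 1, ¬ IsOfFinAddOrder d₁.derivedPoint) → ∃ (n : ℕ) (d :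
      Literature.NumberTheory.EllipticCurves.KolyvaginHeegnerData Dt β ι n) (M : ℕ),
      Literature.NumberTheory.EllipticCurves.KolyvaginDescent.KolSupp
      (Literature.NumberTheory.EllipticCurves.Zhang2014.IsKolyvaginPrime (W.conductorNorm ℤ) W K 2)
      n ∧ 1 ≤ M ∧ (M : ℕ∞) ≤ Literature.NumberTheory.EllipticCurves.Zhang2014.levelIndex W 2 n ∧
      d.kolyvaginClass Nat.prime_two M ≠ 0 := by
  intro W _ _ _ _ hsur K _ _ hK _ hHN hodd _ _ _ Dt β ι _ hex
  obtain ⟨d₁, hnt⟩ := hex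
  have hs : W.HasSurjectiveModNGaloisRep 2 := by simpa using hsur 1
  -- `E(K[1])` is finitely generated (Mordell–Weil over the number field `K[1]`)
  haveI := (finiteDimensional_and_isGalois_ringClassField hK ι one_ne_zero).1
  haveI : NumberField (ringClassField K ι 1) := NumberField.of_module_finite K _
  haveI : (W.baseChange (ringClassField K ι 1)).IsElliptic := by rw [baseChange]; infer_instance
  -- (`convert`: the Subfield-of-`ℂ` vs classical `DecidableEq` inside the group law of `E(K[1])`)
  haveI : Module.Finite ℤ (W.baseChange (ringClassField K ι 1)).toAffine.Point := by
    convert (W.baseChange (ringClassField K ι 1)).module_finite_point_holds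
  -- a level `M ≥ 1` with `2^M ∤ P(1)` (`convert`: decidable-equality instances inside the group law)
  obtain ⟨M, hM1, hndiv⟩ := exists_not_two_pow_zsmul_eq (A := (W.baseChange (ringClassField K ι 1)).toAffine.Point)
    (y := d₁.derivedPoint) (by convert hnt)
  refine ⟨1, d₁, M, KolyvaginDescent.kolSupp_one _, hM1, by simp, ?_⟩
  refine (Summit.BirchSwinnertonDyer.Rank1Residual.X11b.Three.KolyCert.kolyvaginClass_ne_zero_iff
    d₁ Nat.prime_two M).mpr ⟨?_, ?_, ?_⟩
  · exact isAdmissible_pointsSubgroup_two_of_heegner d₁ hs hK hodd hHN one_ne_zero M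
  · exact toGeomPoints_derivedPoint_one_mem_invPoints hK hHN d₁ _
  · rintro ⟨Q, hQ⟩
    exact hndiv ⟨Q, by convert hQ⟩

end Summit.BirchSwinnertonDyer.BirchSwinnertonDyer.Theorems.KolyvaginAtTwo

end
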